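import Mathlib.GroupTheory.Complement
import Mathlib.Algebra.BigOperators.Group.Finset.Basic
import Mathlib.Algebra.Group.Subgroup.Lattice
import Mathlib.Algebra.Ring.Int.Parity
import HarnessLib

/-!
# Transversals of an order-`2` subgroup of a finite abelian group stable under a second involution
# (Monsky 1990, proof of Thm. 4.7: "`φ = φ₀ ∪ Bφ₀`")

Cell `bsd-monsky` (typer seat), kernel work K1 (`run/shared/lean/pub/bsd-monsky/lean/PLAN.md` tier 2), the
combinatorial core of Monsky's Thm. 4.7 ("if `D` is composite, `S_N ∈ Λ_N`"): for commuting elements `π`, `B` of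
order `2` of a finite abelian group `G` with `B ∉ {1, π}`, there is a transversal `φ` of `G/⟨π⟩` (a finset meeting
each coset `{t, πt}` exactly once) which is `B`-stable (`φ = T ∪ B·T` for a transversal `T` of the Klein subgroup
`⟨π, B⟩`), and a `2`-torsion constant summed over any `B`-stable finset vanishes (`B` acts freely: the parity
argument "`φ′ ∩ φ*` is `B`-stable, hence even"). Pure Mathlib; nothing asserted.

[cite: Monsky1990MockHeegner, Thm. 4.7 and its proof (pp. 57–58), Remark (p. 57)] [folklore]
-/

noncomputable section

open scoped Classical

namespace Literature.GroupTheory.FiniteAbelian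

/-- **A `2`-torsion constant summed over a finset stable under a fixed-point-free involution vanishes**
(the parity argument of Monsky Thm. 4.7: "the set … is `B`-stable, hence has an even number of elements").
[cite: Monsky1990MockHeegner, Thm. 4.7 proof (pp. 57–58)] -/
theorem sum_const_eq_zero_of_stable {G : Type*} [CommGroup G] {S : Finset G} {B : G}
    (hB2 : B * B = 1) (hB1 : B ≠ 1) (hS : ∀ t ∈ S, B * t ∈ S) {M : Type*} [AddCommGroup M] {ε : M}
    (hε : ε + ε = 0) : ∑ _t ∈ S, ε = 0 :=
  Finset.sum_involution (fun t _ => B * t) (fun _ _ => hε)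
    (fun a _ _ h => hB1 (mul_right_cancel (h.trans (one_mul a).symm)))
    (fun a ha => hS a ha) (fun a _ => by rw [← mul_assoc, hB2, one_mul])

/-- Stability of a finset under multiplication by `B` ("`φ` is `B`-stable"). [cite: Monsky1990MockHeegner, Thm. 4.7 proof (p. 57)] -/
def IsStableUnder {G : Type*} [CommGroup G] (B : G) (φ : Finset G) : Prop :=
  ∀ t ∈ φ, B * t ∈ φ

/-- Translates of a `B`-stable finset are `B`-stable ("`J⁻¹φ` … is `B`-stable"). [cite: Monsky1990MockHeegner, Thm. 4.7 proof (pp. 57–58)] -/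
theorem isStableUnder_image_mul {G : Type*} [CommGroup G] [DecidableEq G] {B : G} {φ : Finset G}
    (h : IsStableUnder B φ) (s : G) : IsStableUnder B (φ.image (fun t => s * t)) := by
  intro t ht
  rw [Finset.mem_image] at ht ⊢
  obtain ⟨u, hu, rfl⟩ := ht
  exact ⟨B * u, h u hu, by rw [mul_left_comm]⟩

/-- The inverse of a `B`-stable finset is `B`-stable (`B` of order `2`; "`φ⁻¹` … is `B`-stable"). [cite: Monsky1990MockHeegner, Thm. 4.7 proof (pp. 57–58)] -/
theorem isStableUnder_image_inv {G : Type*} [CommGroup G] [DecidableEq G] {B : G} (hB2 : B * B = 1)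
    {φ : Finset G} (h : IsStableUnder B φ) : IsStableUnder B (φ.image (fun t => t⁻¹)) := by
  intro t ht
  rw [Finset.mem_image] at ht ⊢
  obtain ⟨u, hu, rfl⟩ := ht
  refine ⟨B * u, h u hu, ?_⟩
  rw [mul_inv, inv_eq_of_mul_eq_one_right hB2]

/-- The difference of two `B`-stable finsets is `B`-stable ("`φ′ ∩ φ*` is `B`-stable"). [cite: Monsky1990MockHeegner, Thm. 4.7 proof (pp. 57–58)] -/
theorem isStableUnder_filter_not_mem {G : Type*} [CommGroup G] {B : G} (hB2 : B * B = 1)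
    {φ φ' : Finset G} (h : IsStableUnder B φ) (h' : IsStableUnder B φ') :
    IsStableUnder B (φ.filter fun t => t ∉ φ') := by
  intro t ht
  rw [Finset.mem_filter] at ht ⊢
  refine ⟨h t ht.1, fun hm => ht.2 ?_⟩
  have := h' _ hm
  rwa [← mul_assoc, hB2, one_mul] at this

/-- Powers of an element of order `≤ 2` in a commutative group (the Klein subgroup `⟨m, B⟩` of Thm. 4.7's proof). [cite: Monsky1990MockHeegner, Thm. 4.7 proof (p. 57)] -/
theorem zpow_eq_one_or_self_of_mul_self_eq_one {G : Type*} [CommGroup G] {π : G} (hπ : π * π = 1)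
    (m : ℤ) : π ^ m = 1 ∨ π ^ m = π := by
  rcases Int.even_or_odd m with ⟨k, hk⟩ | ⟨k, hk⟩
  · left
    rw [hk, zpow_add, ← mul_zpow, hπ, one_zpow]
  · right
    rw [hk, zpow_add, zpow_one, zpow_mul, zpow_two, hπ, one_zpow, one_mul]

/-- The subgroup generated by two commuting elements of order `2` is `{1, π, B, πB}` (the Klein subgroup `⟨m, B⟩`). [cite: Monsky1990MockHeegner, Thm. 4.7 proof (p. 57)] -/
theorem mem_closure_pair_of_mul_self_eq_one {G : Type*} [CommGroup G] {π B : G} (hπ : π * π = 1)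
    (hB : B * B = 1) {q : G} (hq : q ∈ Subgroup.closure ({π, B} : Set G)) :
    q = 1 ∨ q = π ∨ q = B ∨ q = π * B := by
  obtain ⟨m, k, rfl⟩ := Subgroup.mem_closure_pair.mp hq
  rcases zpow_eq_one_or_self_of_mul_self_eq_one hπ m with h1 | h1 <;>
    rcases zpow_eq_one_or_self_of_mul_self_eq_one hB k with h2 | h2 <;> rw [h1, h2]
  · left; exact one_mul 1
  · right; right; left; exact one_mul B
  · right; left; exact mul_one π
  · right; right; right; rfl

/-- **Existence of a `B`-stable transversal of `G/⟨π⟩`** for commuting elements `π`, `B` of order `2` with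
`B ∉ {1, π}`: take a transversal `T` of the Klein subgroup `⟨π, B⟩` and `φ := T ∪ B·T` (Monsky Thm. 4.7 proof:
"`φ = φ₀ ∪ Bφ₀`"). [cite: Monsky1990MockHeegner, Thm. 4.7 proof (pp. 57–58)] -/
theorem exists_isReps_isStableUnder {G : Type*} [CommGroup G] [Finite G] (π B : G) (hπ2 : π * π = 1)
    (hπ1 : π ≠ 1) (hB2 : B * B = 1) (hB1 : B ≠ 1) (hBπ : B ≠ π) :
    ∃ φ : Finset G, (∀ t, Xor (t ∈ φ) (π * t ∈ φ)) ∧ IsStableUnder B φ := by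
  classical
  set Q : Subgroup G := Subgroup.closure ({π, B} : Set G) with hQ
  have hπQ : π ∈ Q := Subgroup.subset_closure (by simp)
  have hBQ : B ∈ Q := Subgroup.subset_closure (by simp)
  obtain ⟨S, hS, -⟩ := Subgroup.exists_isComplement_left Q 1
  have hS' := Subgroup.isComplement_iff_existsUnique_inv_mul_mem.mp hS
  have hfin : S.Finite := Set.toFinite S
  set T : Finset G := hfin.toFinset with hT
  have hTmem : ∀ t, t ∈ T ↔ t ∈ S := fun t => Set.Finite.mem_toFinset hfin
  refine ⟨T ∪ T.image (fun t => B * t), ?_, ?_⟩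
  · intro t
    have hπinv : π⁻¹ = π := inv_eq_of_mul_eq_one_right hπ2
    have hBinv : B⁻¹ = B := inv_eq_of_mul_eq_one_right hB2
    obtain ⟨⟨r, hrS⟩, hrq, hru⟩ := hS' t
    simp only at hrq hru
    have huniq : ∀ u, u ∈ S → u⁻¹ * t ∈ Q → u = r := fun u hu hut =>
      congrArg Subtype.val (hru ⟨u, hu⟩ hut)
    -- `t = r q` with `q ∈ Q = {1, π, B, πB}`
    set q := r⁻¹ * t with hq
    have htq : t = r * q := by rw [hq, mul_inv_cancel_left]
    have hq4 := mem_closure_pair_of_mul_self_eq_one hπ2 hB2 hrq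
    -- the four membership tests
    have hT1 : t ∈ T ↔ q = 1 := by
      rw [hTmem]
      constructor
      · intro ht
        have := huniq t ht (by rw [inv_mul_cancel]; exact Q.one_mem)
        rw [hq, ← this, inv_mul_cancel]
      · intro h1
        rw [htq, h1, mul_one]; exact hrS
    have hT2 : t ∈ T.image (fun t => B * t) ↔ q = B := by
      rw [Finset.mem_image]
      constructor
      · rintro ⟨u, hu, rfl⟩
        have := huniq u ((hTmem u).mp hu) (by rw [mul_left_comm, inv_mul_cancel, mul_one]; exact hBQ)
        rw [hq, ← this, mul_left_comm, inv_mul_cancel, mul_one]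
      · intro h
        refine ⟨r, (hTmem r).mpr hrS, ?_⟩
        rw [htq, h, mul_comm]
    have hT3 : π * t ∈ T ↔ q = π := by
      rw [hTmem]
      constructor
      · intro ht
        have := huniq (π * t) ht (by rw [mul_inv, inv_mul_cancel_right, hπinv]; exact hπQ)
        rw [hq, ← this, mul_inv, inv_mul_cancel_right, hπinv]
      · intro h
        rw [htq, h, mul_left_comm, hπ2, mul_one]; exact hrS
    have hT4 : π * t ∈ T.image (fun t => B * t) ↔ q = π * B := by
      rw [Finset.mem_image]
      constructor
      · rintro ⟨u, hu, hut⟩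
        have hut' : t = π * (B * u) := by rw [hut, ← mul_assoc, hπ2, one_mul]
        have := huniq u ((hTmem u).mp hu)
          (by rw [hut', mul_left_comm, mul_left_comm u⁻¹ B, inv_mul_cancel, mul_one]; exact Q.mul_mem hπQ hBQ)
        rw [hq, ← this, hut', mul_left_comm, mul_left_comm u⁻¹ B, inv_mul_cancel, mul_one]
      · intro h
        refine ⟨r, (hTmem r).mpr hrS, ?_⟩
        rw [htq, h, ← mul_assoc, ← mul_assoc, mul_comm π r, mul_assoc r π π, hπ2, mul_one, mul_comm]
    -- distinctness of `1, π, B, πB`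
    have hπB1 : π * B ≠ 1 := fun h => hBπ (by rw [← one_mul B, ← hπ2, mul_assoc, h, mul_one])
    have hπBπ : π * B ≠ π := fun h => hB1 (by rw [← one_mul B, ← hπ2, mul_assoc, h, hπ2])
    have hπBB : π * B ≠ B := fun h => hπ1 (by rw [← mul_one π, ← hB2, ← mul_assoc, h, hB2])
    rw [Finset.mem_union, Finset.mem_union, hT1, hT2, hT3, hT4]
    rcases hq4 with h | h | h | h <;> rw [h]
    · exact Or.inl ⟨Or.inl rfl, by rintro (h | h); exact hπ1 h.symm; exact hπB1 h.symm⟩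
    · exact Or.inr ⟨Or.inl rfl, by rintro (h | h); exact hπ1 h; exact hBπ h.symm⟩
    · exact Or.inl ⟨Or.inr rfl, by rintro (h | h); exact hBπ h; exact hπBB h.symm⟩
    · exact Or.inr ⟨Or.inr rfl, by rintro (h | h); exact hπB1 h; exact hπBB h⟩
  · intro t ht
    rw [Finset.mem_union, Finset.mem_image] at ht ⊢
    rcases ht with ht | ⟨u, hu, rfl⟩
    · right; exact ⟨t, ht, rfl⟩
    · left
      rw [← mul_assoc, hB2, one_mul]; exact hu

end Literature.GroupTheory.FiniteAbelian

end
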